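import Literature.Computability.Cryptography.LWEDecisionToSearchSpec
import HarnessLib

/-!
# Regev's decision-to-search reduction for LWE, II: the success probability

Topic `Computability/Cryptography` (LWE), grouping namespace `LWE.DecisionToSearch`, continuing
part I (`LWEDecisionToSearchSpec.lean`: layout, queries `qry`, decision rule `solveBits`, solver
`solve`). Here we prove the probability estimate behind `regev_decision_to_search`
(`LWEHardness.lean`), MACHINE-FREE: for a prime modulus `q ≤ B`, dimension `n ≥ 1`, block size
`m ≥ 1` and ANY acceptance predicate `acc` (the distinguisher) whose AVERAGE-case decision-LWE
advantage on `m` samples is at least `ε = 1/D`,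

  `Pr_{S ← A_{s,χ}^{m'}} [solve acc S = s] ≥ 1 - (2D/R + 64 D² (1 + n B R)/N)`   for EVERY secret `s`

(`DecisionToSearch.le_prob_solve_eq`), and hence the same bound for the average over a uniform `s`
(`le_searchSuccessProb_solve`). The argument is Regev's (2009, §4, proofs of Lemmas 4.1–4.2), with
two routine adaptations recorded in the docstring of `regev_decision_to_search`: the hypothesis is
the average-case advantage, turned into "a fraction `≥ ε/2` of the secrets `s'` have
`|p(s') - p_U| ≥ ε/2`" by Markov's inequality (`card_good_ge`), and Chebyshev's inequality
(`toOuterMeasure_iidPMF_deviation_le`, accuracy `η = ε/16`, failure `≤ 64D²/N` per estimate) replaces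
the Chernoff bound, which suffices for an inverse-polynomial failure probability:

* `prob_badShift_le` — "the distribution of `s + t` is uniform on `ℤ_pⁿ`. Hence … in one of the
  iterations … the acceptance probability of `W` on inputs from `A_{s+t,χ}` and on inputs from `U`
  differ": all `R` shifts miss the good secrets with probability `(1 - γ)^R ≤ 1/(1 + Rγ) ≤ 2D/R`;
* `prob_badU_le`, `prob_badX_le` — each empirical count is within `Nη` of its mean except with
  probability `≤ 64 D²/N` (for the test blocks: conditionally on the shift units, two-stage bound);
* `solve_eq_of_good` — on the complement of these events the rule outputs `s`: the correct guess
  `k = sᵢ` passes at a good shift (counts differ by `> 3N/8D`), every smaller `k` fails at every shift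
  (test block uniform since `q` is prime: counts differ by `< N/8D`);
* the union bound over `1 + 1 + nBR` events.

(The parallel line `LWERegevCore.lean`, `LWE.RegevReduction.outerLaw_output_ne_le_of_advantage`, proves
the analogous bound for its coin-drawing variant of the reduction; see the module doc of part I for
the relation. Nothing is shared beyond `LWERegevTransforms.lean` and Chebyshev.)

## References

* O. Regev, *On lattices, learning with errors, random linear codes, and cryptography*, J. ACM 56
  (2009), art. 34, §4, Lemma 4.1 (Average-case to Worst-case) and Lemma 4.2 (Decision to Search)
  with their proofs; held copy arXiv:2401.03703, p. 23. [cite: RegevLWE2009, §4 Lemma 4.1–4.2]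
* E. Kranakis, *Primality and Cryptography*, Wiley–Teubner 1986, Thm. 3.5 (Chebyshev WLLN, used via
  `LWESampling.lean`). [cite: Kranakis1986, Thm. 3.5]
-/

noncomputable section

open scoped ENNReal
open Finset

namespace Literature.Computability.Cryptography

namespace LWE

namespace DecisionToSearch

open Literature.Probability.Distributions

variable {n q m : ℕ}

/-! ### Acceptance probabilities of a deterministic predicate -/

/-- The acceptance probability of the deterministic verdict `acc` under the law `P`, as a real
number. [cite: RegevLWE2009, §4 ("the acceptance probability of `W` on inputs from …")] -/
def accProb {β : Type} (acc : β → Bool) (P : PMF β) : ℝ :=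
  (P.toOuterMeasure {b | acc b = true}).toReal

/-- The `acceptProb` of `LWE.lean` for the kernel `b ↦ pure (acc b)` is the mass of `{acc = true}`.
Twin (same statement): `acceptProb_pure` of `LWESearchToDecision.lean`, the top file of the
search-to-decision line, which is not in this file's import closure (it would pull in that line's
machine files); the intended survivor is whichever copy a common lower file (`LWE.lean`) absorbs. [folklore] -/
theorem acceptProb_pure {β : Type} (acc : β → Bool) (P : PMF β) :
    acceptProb (fun b => PMF.pure (acc b)) P = P.toOuterMeasure {b | acc b = true} := by
  unfold acceptProb
  rw [show (P.bind fun b => PMF.pure (acc b)) = P.map acc from rfl, ← PMF.toOuterMeasure_apply_singleton,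
    PMF.toOuterMeasure_map_apply]
  rfl

/-- `accProb` is the real reading of `acceptProb` of the pure kernel. [folklore] -/
theorem accProb_eq {β : Type} (acc : β → Bool) (P : PMF β) :
    accProb acc P = (acceptProb (fun b => PMF.pure (acc b)) P).toReal := by
  rw [acceptProb_pure]; rfl

/-- `0 ≤ accProb`. [folklore] -/
theorem accProb_nonneg {β : Type} (acc : β → Bool) (P : PMF β) : 0 ≤ accProb acc P :=
  ENNReal.toReal_nonneg

/-- `|accProb - accProb| ≤ 1`. [folklore] -/
theorem abs_accProb_sub_le_one {β γ : Type} (acc : β → Bool) (P : PMF β) (acc' : γ → Bool) (Q : PMF γ) :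
    |accProb acc P - accProb acc' Q| ≤ 1 := by
  rw [accProb_eq, accProb_eq]
  exact abs_toReal_acceptProb_sub_le_one _ _ _ _

section Main

variable [NeZero q] (P : Params) (χ : PMF (ZMod q)) (acc : (Fin m → (Fin n → ZMod q) × ZMod q) → Bool)

/-- `p(s') = Pr[acc accepts A_{s',χ}^m]`. [cite: RegevLWE2009, §4 (proof of Lemma 4.1)] -/
def pL (s' : Fin n → ZMod q) : ℝ := accProb acc (lweSamples χ s' m)

/-- `p_U = Pr[acc accepts U^m]`. [cite: RegevLWE2009, §4 (proof of Lemma 4.1)] -/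
def pU : ℝ := accProb acc (uniformSamples (Fin n) (ZMod q) m)

/-- The GOOD secrets: those on which `acc` has advantage at least `ε/2 = 1/(2D)`.
[cite: RegevLWE2009, §4 (Lemma 4.1: "for a non-negligible fraction of all possible `s`")] -/
def good : Finset (Fin n → ZMod q) :=
  univ.filter fun s' => (1 / (2 * P.D) : ℝ) ≤ |pL χ acc s' - pU (n := n) (m := m) acc|

/-! ### Markov: an average advantage `ε` gives advantage `ε/2` on a fraction `ε/2` of the secrets -/

/-- **Markov step.** If the average-case advantage of `acc` is at least `1/D` then at least a
fraction `1/(2D)` of the secrets is good. (`ε ≤ |E_s p(s) - p_U| ≤ E_s |p(s) - p_U| ≤ γ·1 + (1-γ)·ε/2`.)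
[cite: RegevLWE2009, §4 Lemma 4.1 (hypothesis)] -/
theorem card_good_ge (hD : 0 < P.D)
    (hadv : (1 / P.D : ℝ) ≤ distinguishingAdvantage χ m (fun b => PMF.pure (acc b))) :
    (1 / (2 * P.D) : ℝ) ≤ ((good P χ acc).card : ℝ) / Fintype.card (Fin n → ZMod q) := by
  set C : ℕ := Fintype.card (Fin n → ZMod q) with hC
  have hCpos : (0 : ℝ) < C := by rw [hC]; exact_mod_cast Fintype.card_pos
  set f : (Fin n → ZMod q) → ℝ := fun s' => |pL χ acc s' - pU (n := n) (m := m) acc| with hf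
  -- `1/D ≤ E_s |p(s) - p_U|`
  have h1 : (1 / P.D : ℝ) ≤ ∑ s', (1 / C : ℝ) * f s' := by
    refine hadv.trans ((distinguishingAdvantage_le_sum_holds χ m _).trans (le_of_eq ?_))
    refine Finset.sum_congr rfl fun s' _ => ?_
    rw [PMF.uniformOfFintype_apply, ENNReal.toReal_inv, ENNReal.toReal_natCast, one_div, hf]
    simp only [distinguishingAdvantageOf, pL, pU, accProb_eq, hC]
  -- split the average over good and bad secrets
  have h2 : ∑ s', (1 / C : ℝ) * f s' ≤ (good P χ acc).card / C + 1 / (2 * P.D) := by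
    rw [← Finset.mul_sum, ← Finset.sum_filter_add_sum_filter_not univ
      (fun s' => (1 / (2 * P.D) : ℝ) ≤ |pL χ acc s' - pU (n := n) (m := m) acc|)]
    have hg : ∑ s' ∈ univ.filter (fun s' => (1 / (2 * P.D) : ℝ) ≤ |pL χ acc s' - pU (n := n) (m := m) acc|), f s'
        ≤ (good P χ acc).card := by
      have : ∑ s' ∈ good P χ acc, f s' ≤ ∑ _s' ∈ good P χ acc, (1 : ℝ) :=
        Finset.sum_le_sum fun s' _ => abs_accProb_sub_le_one _ _ _ _
      simpa [good] using this
    have hb : ∑ s' ∈ univ.filter (fun s' => ¬ (1 / (2 * P.D) : ℝ) ≤ |pL χ acc s' - pU (n := n) (m := m) acc|), f s'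
        ≤ C * (1 / (2 * P.D)) := by
      refine (Finset.sum_le_sum (g := fun _ => (1 / (2 * P.D) : ℝ)) fun s' hs' => ?_).trans ?_
      · exact (not_le.1 (Finset.mem_filter.1 hs').2).le
      · rw [Finset.sum_const, nsmul_eq_mul]
        refine mul_le_mul_of_nonneg_right ?_ (by positivity)
        exact_mod_cast (Finset.card_filter_le _ _).trans (Finset.card_univ (α := Fin n → ZMod q)).le
    calc (1 / C : ℝ) * (∑ s' ∈ univ.filter _, f s' + ∑ s' ∈ univ.filter _, f s')
        ≤ (1 / C) * ((good P χ acc).card + C * (1 / (2 * P.D))) := by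
          exact mul_le_mul_of_nonneg_left (add_le_add hg hb) (by positivity)
      _ = (good P χ acc).card / C + 1 / (2 * P.D) := by field_simp
  have h3 : (1 / P.D : ℝ) = 1 / (2 * P.D) + 1 / (2 * P.D) := by field_simp; ring
  linarith [h1.trans h2]

/-! ### The parts of the input tuple and their laws -/

variable (s : Fin n → ZMod q)

/-- The law of one unit: `W = A_{s,χ}^{2m}`. [folklore] -/
abbrev W : PMF (Fin (m + m) → (Fin n → ZMod q) × ZMod q) := lweSamples χ s (m + m)

/-- The shift units of the input. [folklore] -/
def tPart (S : Fin (P.total n m) → (Fin n → ZMod q) × ZMod q) : Fin P.R → Fin (m + m) → (Fin n → ZMod q) × ZMod q :=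
  fun r => Params.units S (P.tUnit n r)

/-- The uniform units of the input. [folklore] -/
def uPart (S : Fin (P.total n m) → (Fin n → ZMod q) × ZMod q) : Fin P.N → Fin (m + m) → (Fin n → ZMod q) × ZMod q :=
  fun j => Params.units S (P.uUnit n j)

/-- The test units of group `g`. [folklore] -/
def xPart (S : Fin (P.total n m) → (Fin n → ZMod q) × ZMod q) (g : Fin (P.groups n)) :
    Fin P.N → Fin (m + m) → (Fin n → ZMod q) × ZMod q :=
  fun j => Params.units S (P.xUnit g j)

/-- The units past the shift units. [folklore] -/
def restPart (S : Fin (P.total n m) → (Fin n → ZMod q) × ZMod q) :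
    Fin (P.N + P.groups n * P.N) → Fin (m + m) → (Fin n → ZMod q) × ZMod q :=
  ((Fin.appendEquiv P.R (P.N + P.groups n * P.N)).symm (Params.units S)).2

omit [NeZero q] in
/-- `tPart` is the first block of the units. [folklore] -/
theorem tPart_eq (S : Fin (P.total n m) → (Fin n → ZMod q) × ZMod q) :
    tPart P S = ((Fin.appendEquiv P.R (P.N + P.groups n * P.N)).symm (Params.units S)).1 :=
  rfl

omit [NeZero q] in
/-- `uPart` is the first block of the rest. [folklore] -/
theorem uPart_eq (S : Fin (P.total n m) → (Fin n → ZMod q) × ZMod q) :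
    uPart P S = ((Fin.appendEquiv P.N (P.groups n * P.N)).symm (restPart P S)).1 :=
  rfl

omit [NeZero q] in
/-- `xPart g` is block `g` of the second block of the rest. [folklore] -/
theorem xPart_eq (S : Fin (P.total n m) → (Fin n → ZMod q) × ZMod q) (g : Fin (P.groups n)) :
    xPart P S g = blocksOf (P.groups n) P.N ((Fin.appendEquiv P.N (P.groups n * P.N)).symm (restPart P S)).2 g :=
  rfl

/-- **The units of the input are iid of law `W`.** [cite: RegevLWE2009, §2 (independent samples)] -/
theorem law_units : (lweSamples χ s (P.total n m)).map (Params.units (P := P)) = iidPMF (W χ s) (P.K n) :=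
  iidPMF_map_blocksOf _ _ _

/-- **Shift units and the rest are independent.** [cite: RegevLWE2009, §2 (independent samples)] -/
theorem law_tPart_restPart :
    (lweSamples χ s (P.total n m)).map (fun S => (tPart P S, restPart P S)) =
      prodLaw (iidPMF (W χ s) P.R) (iidPMF (W χ s) (P.N + P.groups n * P.N)) := by
  rw [show (fun S => (tPart P S, restPart P S)) =
      (Fin.appendEquiv P.R (P.N + P.groups n * P.N)).symm ∘ Params.units (P := P) (n := n) (m := m) (q := q) from rfl,
    ← PMF.map_comp, law_units]
  exact iidPMF_map_appendEquiv_symm _ _ _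

/-- **The shift units are iid of law `W`.** [cite: RegevLWE2009, §2 (independent samples)] -/
theorem law_tPart : (lweSamples χ s (P.total n m)).map (tPart P) = iidPMF (W χ s) P.R := by
  rw [show tPart P (n := n) (m := m) (q := q) = Prod.fst ∘ fun S => (tPart P S, restPart P S) from rfl,
    ← PMF.map_comp, law_tPart_restPart, prodLaw_map_fst]

/-- The law of the rest. [folklore] -/
theorem law_restPart :
    (lweSamples χ s (P.total n m)).map (restPart P) = iidPMF (W χ s) (P.N + P.groups n * P.N) := by
  rw [show restPart P (n := n) (m := m) (q := q) = Prod.snd ∘ fun S => (tPart P S, restPart P S) from rfl,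
    ← PMF.map_comp, law_tPart_restPart, prodLaw_map_snd]

/-- **The uniform units are iid of law `W`.** [cite: RegevLWE2009, §2 (independent samples)] -/
theorem law_uPart : (lweSamples χ s (P.total n m)).map (uPart P) = iidPMF (W χ s) P.N := by
  rw [show uPart P (n := n) (m := m) (q := q) =
      Prod.fst ∘ ((Fin.appendEquiv P.N (P.groups n * P.N)).symm ∘ restPart P) from rfl,
    ← PMF.map_comp, ← PMF.map_comp, law_restPart, iidPMF_map_appendEquiv_symm, prodLaw_map_fst]

/-- The map from the rest to the test units of group `g`. [folklore] -/
def xOfRest (g : Fin (P.groups n)) (rest : Fin (P.N + P.groups n * P.N) → Fin (m + m) → (Fin n → ZMod q) × ZMod q) :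
    Fin P.N → Fin (m + m) → (Fin n → ZMod q) × ZMod q :=
  blocksOf (P.groups n) P.N ((Fin.appendEquiv P.N (P.groups n * P.N)).symm rest).2 g

/-- The test units of a group are iid of law `W` (from the rest). [folklore] -/
theorem law_xOfRest (g : Fin (P.groups n)) :
    (iidPMF (W (m := m) χ s) (P.N + P.groups n * P.N)).map (xOfRest P g) = iidPMF (W χ s) P.N := by
  rw [show xOfRest P (n := n) (m := m) (q := q) g =
      (fun w => w g) ∘ (blocksOf (P.groups n) P.N ∘ (Prod.snd ∘ (Fin.appendEquiv P.N (P.groups n * P.N)).symm)) from rfl,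
    ← PMF.map_comp, ← PMF.map_comp, ← PMF.map_comp, iidPMF_map_appendEquiv_symm, prodLaw_map_snd,
    iidPMF_map_blocksOf, iidPMF_map_eval]

/-- **Shift units and the test units of one group are independent iid families of law `W`.**
[cite: RegevLWE2009, §2 (independent samples)] -/
theorem law_tPart_xPart (g : Fin (P.groups n)) :
    (lweSamples χ s (P.total n m)).map (fun S => (tPart P S, xPart P S g)) =
      prodLaw (iidPMF (W χ s) P.R) (iidPMF (W χ s) P.N) := by
  rw [show (fun S => (tPart P S, xPart P S g)) =
      Prod.map id (xOfRest P g) ∘ fun S => (tPart P (n := n) (m := m) (q := q) S, restPart P S) from rfl,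
    ← PMF.map_comp, law_tPart_restPart, prodLaw_map_prodMap, PMF.map_id, law_xOfRest]

/-! ### The three kinds of bad events and their probabilities -/

/-- The accuracy of the estimates: `η = ε/16 = 1/(16 D)`. [cite: RegevLWE2009, §4 (proof of Lemma 4.1: "within `± n^{-c₂}/8`"; here `/16` with Chebyshev)] -/
def eta (P : Params) : ℝ := 1 / (16 * P.D)

/-- `η > 0`. [folklore] -/
theorem eta_pos (hD : 0 < P.D) : 0 < eta P := by
  unfold eta; positivity

/-- `1/(4 N η²) = 64 D²/N`. [folklore] -/
theorem chebyshev_const (hN : 0 < P.N) (hD : 0 < P.D) :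
    (1 / (4 * P.N * eta P ^ 2) : ℝ) = 64 * (P.D : ℝ) ^ 2 / P.N := by
  unfold eta
  have hN' : (0 : ℝ) < P.N := by exact_mod_cast hN
  have hD' : (0 : ℝ) < P.D := by exact_mod_cast hD
  field_simp
  ring

/-- The accepted event of the distinguisher. [folklore] -/
def E : Set (Fin m → (Fin n → ZMod q) × ZMod q) := {b | acc b = true}

/-- **Bad shifts**: no shift `t_r` moves `s` to a good secret. [cite: RegevLWE2009, §4 (proof of Lemma 4.1)] -/
def badShift (S : Fin (P.total n m) → (Fin n → ZMod q) × ZMod q) : Prop :=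
  ∀ r : Fin P.R, s + Params.tVec S r ∉ good P χ acc

/-- The empirical count of accepted uniform blocks (as a real sum of indicators). [folklore] -/
def sumU (S : Fin (P.total n m) → (Fin n → ZMod q) × ZMod q) : ℝ :=
  ∑ j : Fin P.N, (E acc).indicator (fun _ => (1 : ℝ)) (Params.ublk S j)

/-- **Bad uniform estimate**: the count of accepted uniform blocks is `Nη`-far from `N p_U`.
[cite: RegevLWE2009, §4 (proof of Lemma 4.1)] -/
def badU (S : Fin (P.total n m) → (Fin n → ZMod q) × ZMod q) : Prop :=
  (P.N : ℝ) * eta P ≤ |sumU P acc S - P.N * pU acc|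

/-- The mean of a test count: `p(s + t_r)` for the correct guess, `p_U` for a wrong one.
[cite: RegevLWE2009, §4 (proof of Lemma 4.2)] -/
def μX (i : Fin n) (k : Fin P.B) (t : Fin n → ZMod q) : ℝ :=
  if ((k.val : ℕ) : ZMod q) = s i then pL χ acc (s + t) else pU (n := n) (m := m) acc

/-- The empirical count of accepted test blocks of group `g`. [folklore] -/
def sumX (g : Fin (P.groups n)) (S : Fin (P.total n m) → (Fin n → ZMod q) × ZMod q) : ℝ :=
  ∑ j : Fin P.N, (E acc).indicator (fun _ => (1 : ℝ)) (Params.xblk S g j)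

/-- **Bad test estimate** for group `g = (i, k, r)`: the count is `Nη`-far from `N` times its mean.
[cite: RegevLWE2009, §4 (proofs of Lemmas 4.1–4.2)] -/
def badX (g : Fin (P.groups n)) (S : Fin (P.total n m) → (Fin n → ZMod q) × ZMod q) : Prop :=
  (P.N : ℝ) * eta P ≤ |sumX P acc g S - P.N * μX P χ acc s (P.ikr g).1.1 (P.ikr g).1.2 (Params.tVec S (P.ikr g).2)|

/-! #### Bad shifts -/

/-- The number of shifts NOT leading to a good secret is the number of bad secrets. [folklore] -/
theorem card_filter_add_notMem :
    (univ.filter fun t : Fin n → ZMod q => s + t ∉ good P χ acc).card =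
      Fintype.card (Fin n → ZMod q) - (good P χ acc).card := by
  rw [← Finset.card_compl, ← Finset.card_map (addLeftEmbedding s)]
  congr 1
  ext x
  simp only [Finset.mem_map, Finset.mem_filter, Finset.mem_univ, true_and, addLeftEmbedding_apply,
    Finset.mem_compl]
  constructor
  · rintro ⟨t, ht, rfl⟩; exact ht
  · intro hx; exact ⟨-s + x, by simpa using hx, by simp⟩

/-- `(1 - γ)^R ≤ 1/(1 + Rγ)` for `γ ∈ [0, 1]`. [folklore] -/
theorem one_sub_pow_le (γ : ℝ) (h0 : 0 ≤ γ) (h1 : γ ≤ 1) (R : ℕ) : (1 - γ) ^ R ≤ 1 / (1 + R * γ) := by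
  rw [le_div_iff₀ (by positivity)]
  calc (1 - γ) ^ R * (1 + R * γ) ≤ (1 - γ) ^ R * (1 + γ) ^ R := by
        exact mul_le_mul_of_nonneg_left (one_add_mul_le_pow (by linarith) R) (pow_nonneg (by linarith) R)
    _ = (1 - γ ^ 2) ^ R := by rw [← mul_pow]; ring
    _ ≤ 1 := pow_le_one₀ (by nlinarith) (by nlinarith)

/-- **Probability of bad shifts**: `Pr[∀ r, s + t_r ∉ good] ≤ 2D/R` (the `t_r` are iid uniform, so
`s + t_r` is uniform and good with probability `γ ≥ 1/(2D)`; `(1-γ)^R ≤ 1/(1 + Rγ) ≤ 2D/R`).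
[cite: RegevLWE2009, §4 (proof of Lemma 4.1: "the distribution of `s + t` is uniform on `ℤ_pⁿ`")] -/
theorem prob_badShift_le (hm : 0 < m) (hR : 0 < P.R) (hD : 0 < P.D)
    (hadv : (1 / P.D : ℝ) ≤ distinguishingAdvantage χ m (fun b => PMF.pure (acc b))) :
    (lweSamples χ s (P.total n m)).toOuterMeasure {S | badShift P χ acc s S} ≤
      ENNReal.ofReal (2 * P.D / P.R) := by
  classical
  set C : ℕ := Fintype.card (Fin n → ZMod q) with hC
  set g : ℕ := (good P χ acc).card with hg
  have hCpos : (0 : ℝ) < C := by rw [hC]; exact_mod_cast Fintype.card_pos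
  have hgC : g ≤ C := by rw [hg, hC]; exact (Finset.card_le_univ _)
  set A : Set (Fin n → ZMod q) := {t | s + t ∉ good P χ acc} with hA
  -- the event through the tuple of shift vectors
  have hset : {S : Fin (P.total n m) → (Fin n → ZMod q) × ZMod q | badShift P χ acc s S} =
      (fun S r => tOf (tPart P S r)) ⁻¹' {v | ∀ r, v r ∈ A} := rfl
  have hlaw : (lweSamples χ s (P.total n m)).map (fun S r => tOf (tPart P S r)) =
      iidPMF (PMF.uniformOfFintype (Fin n → ZMod q)) P.R := by
    rw [show (fun S r => tOf (tPart P (n := n) (m := m) (q := q) S r)) =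
        (fun T => tOf ∘ T) ∘ tPart P from rfl, ← PMF.map_comp, law_tPart, iidPMF_map,
      lweSamples_map_tOf χ s hm]
  rw [hset, ← PMF.toOuterMeasure_map_apply, hlaw, toOuterMeasure_iidPMF_forall]
  -- the mass of `A` under the uniform law
  have hmass : (PMF.uniformOfFintype (Fin n → ZMod q)).toOuterMeasure A = ENNReal.ofReal (1 - g / C) := by
    have hAfin : A = ↑(univ.filter fun t : Fin n → ZMod q => s + t ∉ good P χ acc) := by
      ext t; simp [hA]
    rw [hAfin, PMF.toOuterMeasure_apply_finset]
    simp only [PMF.uniformOfFintype_apply, Finset.sum_const, nsmul_eq_mul]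
    rw [card_filter_add_notMem, ← hC, ← hg]
    rw [show (1 - g / C : ℝ) = ((C - g : ℕ) : ℝ) / C by
      rw [Nat.cast_sub hgC]; field_simp]
    rw [ENNReal.ofReal_div_of_pos hCpos, ENNReal.ofReal_natCast, ENNReal.ofReal_natCast, div_eq_mul_inv]
  rw [hmass, ← ENNReal.ofReal_pow (by
    rw [sub_nonneg, div_le_one hCpos]; exact_mod_cast hgC)]
  refine ENNReal.ofReal_le_ofReal ?_
  -- the real inequality
  have hγ : (1 / (2 * P.D) : ℝ) ≤ g / C := card_good_ge P χ acc hD hadv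
  have hγ1 : (g : ℝ) / C ≤ 1 := by rw [div_le_one hCpos]; exact_mod_cast hgC
  have hDpos : (0 : ℝ) < P.D := by exact_mod_cast hD
  have hRpos : (0 : ℝ) < P.R := by exact_mod_cast hR
  calc (1 - (g : ℝ) / C) ^ P.R ≤ 1 / (1 + P.R * (g / C)) :=
        one_sub_pow_le _ (le_trans (by positivity) hγ) hγ1 P.R
    _ ≤ 1 / (P.R * (1 / (2 * P.D))) := by
        refine one_div_le_one_div_of_le (by positivity) ?_
        nlinarith [mul_le_mul_of_nonneg_left hγ hRpos.le]
    _ = 2 * P.D / P.R := by field_simp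

/-! #### Bad uniform estimate -/

/-- **Probability of a bad uniform estimate**: `≤ 64 D²/N` (Chebyshev; the uniform blocks are iid
`U^m`; Chebyshev as in Kranakis 1986 Thm. 3.5). [cite: RegevLWE2009, §4 (proof of Lemma 4.1)] -/
theorem prob_badU_le (hn : 0 < n) (hN : 0 < P.N) (hD : 0 < P.D) :
    (lweSamples χ s (P.total n m)).toOuterMeasure {S | badU P acc S} ≤
      ENNReal.ofReal (64 * (P.D : ℝ) ^ 2 / P.N) := by
  have hset : {S : Fin (P.total n m) → (Fin n → ZMod q) × ZMod q | badU P acc S} =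
      (fun S j => Params.ublk (P := P) S j) ⁻¹'
        {v | (P.N : ℝ) * eta P ≤ |(∑ j, (E acc).indicator (fun _ => (1 : ℝ)) (v j)) -
          P.N * ((uniformSamples (Fin n) (ZMod q) m).toOuterMeasure (E acc)).toReal|} := rfl
  have hlaw : (lweSamples χ s (P.total n m)).map (fun S j => Params.ublk (P := P) S j) =
      iidPMF (uniformSamples (Fin n) (ZMod q) m) P.N := by
    rw [show (fun S j => Params.ublk (P := P) (n := n) (m := m) (q := q) S j) =
        (fun U => ublkOf ∘ U) ∘ uPart P from rfl, ← PMF.map_comp, law_uPart, iidPMF_map,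
      lweSamples_map_ublkOf χ s hn]
  rw [hset, ← PMF.toOuterMeasure_map_apply, hlaw, ← chebyshev_const P hN hD]
  exact toOuterMeasure_iidPMF_deviation_le _ _ hN (eta_pos P hD)

/-! #### Bad test estimates -/

/-- The mean of the test bit of group `(i, k, r)` given the shift `t`: the mass of the accepted
event under the law of the test block, `A_{s+t,χ}^m` or `U^m`. [cite: RegevLWE2009, §4 (proof of Lemma 4.2)] -/
theorem toReal_W_preimage [Fact (Nat.Prime q)] (i : Fin n) (k : Fin P.B) (t : Fin n → ZMod q) :
    ((W χ s).toOuterMeasure (xblkOf i ((k.val : ℕ) : ZMod q) t ⁻¹' E (m := m) acc)).toReal = μX P χ acc s i k t := by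
  rw [← PMF.toOuterMeasure_map_apply]
  unfold μX
  split_ifs with hk
  · rw [hk, lweSamples_map_xblkOf_self χ s]; rfl
  · rw [lweSamples_map_xblkOf_of_ne χ s i hk]; rfl

/-- **Probability of a bad test estimate**: `≤ 64 D²/N` for every group (two-stage: conditionally on
the shift units the `N` test blocks of the group are iid of law `A_{s+t_r,χ}^m` or `U^m`, then
Chebyshev as in Kranakis 1986 Thm. 3.5). [cite: RegevLWE2009, §4 (proofs of Lemmas 4.1–4.2)] -/
theorem prob_badX_le [Fact (Nat.Prime q)] (hN : 0 < P.N) (hD : 0 < P.D) (g : Fin (P.groups n)) :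
    (lweSamples χ s (P.total n m)).toOuterMeasure {S | badX P χ acc s g S} ≤
      ENNReal.ofReal (64 * (P.D : ℝ) ^ 2 / P.N) := by
  set i := (P.ikr g).1.1
  set k := (P.ikr g).1.2
  set r := (P.ikr g).2
  have hset : {S : Fin (P.total n m) → (Fin n → ZMod q) × ZMod q | badX P χ acc s g S} =
      (fun S => (tPart P S, xPart P S g)) ⁻¹'
        {p | (P.N : ℝ) * eta P ≤ |(∑ j, (E acc).indicator (fun _ => (1 : ℝ)) (xblkOf i ((k.val : ℕ) : ZMod q) (tOf (p.1 r)) (p.2 j))) -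
          P.N * μX P χ acc s i k (tOf (p.1 r))|} := rfl
  rw [hset, ← PMF.toOuterMeasure_map_apply, law_tPart_xPart, ← chebyshev_const P hN hD]
  refine toOuterMeasure_prodLaw_le _ _ _ fun τ => ?_
  have hsec : Prod.mk τ ⁻¹' {p : (Fin P.R → Fin (m + m) → (Fin n → ZMod q) × ZMod q) × (Fin P.N → Fin (m + m) → (Fin n → ZMod q) × ZMod q) |
      (P.N : ℝ) * eta P ≤ |(∑ j, (E acc).indicator (fun _ => (1 : ℝ)) (xblkOf i ((k.val : ℕ) : ZMod q) (tOf (p.1 r)) (p.2 j))) -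
        P.N * μX P χ acc s i k (tOf (p.1 r))|} =
      {ξ | (P.N : ℝ) * eta P ≤ |(∑ j, (xblkOf i ((k.val : ℕ) : ZMod q) (tOf (τ r)) ⁻¹' E (m := m) acc).indicator (fun _ => (1 : ℝ)) (ξ j)) -
        P.N * ((W χ s).toOuterMeasure (xblkOf i ((k.val : ℕ) : ZMod q) (tOf (τ r)) ⁻¹' E (m := m) acc)).toReal|} := by
    ext ξ
    simp only [Set.mem_preimage, Set.mem_setOf_eq, toReal_W_preimage P χ acc s]
    rfl
  rw [hsec]
  exact toOuterMeasure_iidPMF_deviation_le _ _ hN (eta_pos P hD)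

/-! ### On the complement of the bad events the rule finds `s` -/

omit [NeZero q] in
/-- The count of accepted uniform blocks read by the rule is the empirical count. [folklore] -/
theorem cntU_bitsOf (S : Fin (P.total n m) → (Fin n → ZMod q) × ZMod q) :
    (P.cntU (Params.bitsOf acc S) : ℝ) = sumU P acc S := by
  classical
  unfold Params.cntU sumU
  rw [Nat.cast_sum, ← Fin.sum_univ_eq_sum_range]
  refine Finset.sum_congr rfl fun j _ => ?_
  rw [Params.bitsOf_lt, Set.indicator_apply]
  by_cases h : acc (Params.ublk S j) = true <;> simp [E, h]

omit [NeZero q] in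
/-- The count of accepted test blocks read by the rule is the empirical count. [folklore] -/
theorem cntX_bitsOf (S : Fin (P.total n m) → (Fin n → ZMod q) × ZMod q) (i : Fin n) (k : Fin P.B) (r : Fin P.R) :
    (P.cntX (Params.bitsOf acc S) i.val k.val r.val : ℝ) = sumX P acc (P.gOf i k r) S := by
  classical
  unfold Params.cntX sumX
  rw [Nat.cast_sum, ← Fin.sum_univ_eq_sum_range]
  refine Finset.sum_congr rfl fun j _ => ?_
  rw [Params.gIdx_eq_val_gOf, Params.bitsOf_xIdx, Set.indicator_apply]
  by_cases h : acc (Params.xblk S (P.gOf i k r) j) = true <;> simp [E, h]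

/-- Reading `far` over the reals. [folklore] -/
theorem far_eq_true_iff (A C : ℕ) : P.far A C = true ↔ (P.N : ℝ) ≤ 4 * P.D * |(A : ℝ) - C| := by
  unfold Params.far
  rw [decide_eq_true_iff, ← Nat.cast_le (α := ℝ)]
  push_cast
  rw [Nat.cast_natAbs, Int.cast_abs]
  push_cast
  exact Iff.rfl

/-- **The deterministic core.** If some shift leads to a good secret, the uniform count is
`Nη`-close to `N p_U` and every test count is `Nη`-close to `N` times its mean (`η = 1/(16D)`),
then the rule outputs `s`: for each coordinate `i`, the guess `k = sᵢ` passes (at the good shift the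
means differ by `≥ N/2D`, so the counts differ by `> 3N/8D ≥ N/4D`) and every `k < sᵢ` fails at
every shift (its test blocks are uniform: counts differ by `< N/8D`). [cite: RegevLWE2009, §4 (proofs of Lemmas 4.1–4.2)] -/
theorem solve_eq_of_good (hB : q ≤ P.B) (hN : 0 < P.N) (hD : 0 < P.D)
    (S : Fin (P.total n m) → (Fin n → ZMod q) × ZMod q)
    (hshift : ¬ badShift P χ acc s S) (hU : ¬ badU P acc S) (hX : ∀ g, ¬ badX P χ acc s g S) :
    Params.solve acc S = s := by
  classical
  have hDpos : (0 : ℝ) < P.D := by exact_mod_cast hD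
  have hNpos : (0 : ℝ) < P.N := by exact_mod_cast hN
  have hη : (P.N : ℝ) * eta P = P.N / (16 * P.D) := by unfold eta; ring
  obtain ⟨r₀, hr₀⟩ := not_forall_not.1 (fun h => hshift fun r => h r)
  have hgood : (1 / (2 * P.D) : ℝ) ≤ |pL χ acc (s + Params.tVec S r₀) - pU (n := n) (m := m) acc| := by
    simpa [good] using hr₀
  have hU' : |sumU P acc S - P.N * pU acc| < P.N * eta P := not_le.1 hU
  funext i
  -- the value of the correct guess
  set kk : ℕ := (s i).val with hkk
  have hkkq : kk < q := ZMod.val_lt (s i)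
  have hkkB : kk < P.B := lt_of_lt_of_le hkkq hB
  have hcast : ((kk : ℕ) : ZMod q) = s i := ZMod.natCast_zmod_val (s i)
  -- the correct guess passes
  have hpass : P.passes (Params.bitsOf acc S) i.val kk = true := by
    rw [Params.passes, List.any_eq_true]
    refine ⟨r₀.val, List.mem_range.2 r₀.isLt, ?_⟩
    rw [far_eq_true_iff, cntU_bitsOf, show kk = (⟨kk, hkkB⟩ : Fin P.B).val from rfl,
      show r₀.val = r₀.val from rfl, cntX_bitsOf P acc S i ⟨kk, hkkB⟩ r₀]
    have hXg := not_le.1 (hX (P.gOf i ⟨kk, hkkB⟩ r₀))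
    simp only [Params.ikr_gOf, μX, hcast, if_true] at hXg
    -- |cX - cU| > N/(2D) - 2Nη = 3N/(8D)
    have key : (P.N : ℝ) / (2 * P.D) - 2 * (P.N * eta P) ≤
        |sumX P acc (P.gOf i ⟨kk, hkkB⟩ r₀) S - sumU P acc S| := by
      have h1 : (P.N : ℝ) / (2 * P.D) ≤ |P.N * pL χ acc (s + Params.tVec S r₀) - P.N * pU (n := n) (m := m) acc| := by
        rw [← mul_sub, abs_mul, abs_of_pos hNpos]
        calc (P.N : ℝ) / (2 * P.D) = P.N * (1 / (2 * P.D)) := by ring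
          _ ≤ P.N * |pL χ acc (s + Params.tVec S r₀) - pU acc| := mul_le_mul_of_nonneg_left hgood hNpos.le
      have tri := abs_sub_abs_le_abs_sub (P.N * pL χ acc (s + Params.tVec S r₀) - P.N * pU (n := n) (m := m) acc)
        ((P.N * pL χ acc (s + Params.tVec S r₀) - sumX P acc (P.gOf i ⟨kk, hkkB⟩ r₀) S) + (sumU P acc S - P.N * pU acc))
      have tri2 := abs_add_le (P.N * pL χ acc (s + Params.tVec S r₀) - sumX P acc (P.gOf i ⟨kk, hkkB⟩ r₀) S) (sumU P acc S - P.N * pU acc)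
      rw [abs_sub_comm] at hXg
      have e : P.N * pL χ acc (s + Params.tVec S r₀) - P.N * pU (n := n) (m := m) acc -
          ((P.N * pL χ acc (s + Params.tVec S r₀) - sumX P acc (P.gOf i ⟨kk, hkkB⟩ r₀) S) + (sumU P acc S - P.N * pU acc)) =
          sumX P acc (P.gOf i ⟨kk, hkkB⟩ r₀) S - sumU P acc S := by ring
      rw [e] at tri
      linarith
    have e16 : (P.N : ℝ) / (2 * P.D) - 2 * (P.N * eta P) = 3 * P.N / (8 * P.D) := by rw [hη]; field_simp; ring
    rw [e16] at key
    calc (P.N : ℝ) ≤ 4 * P.D * (3 * P.N / (8 * P.D)) := by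
          rw [show 4 * (P.D : ℝ) * (3 * P.N / (8 * P.D)) = 3 / 2 * P.N by field_simp; norm_num]; linarith
      _ ≤ 4 * P.D * |sumX P acc (P.gOf i ⟨kk, hkkB⟩ r₀) S - sumU P acc S| :=
          mul_le_mul_of_nonneg_left key (by positivity)
  -- every smaller guess fails
  have hfail : ∀ k' < kk, P.passes (Params.bitsOf acc S) i.val k' = false := by
    intro k' hk'
    have hk'B : k' < P.B := hk'.trans hkkB
    have hne : ((k' : ℕ) : ZMod q) ≠ s i := by
      intro h
      have := congrArg ZMod.val h
      rw [ZMod.val_natCast_of_lt (hk'.trans hkkq)] at this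
      exact (lt_irrefl _) (this ▸ hk')
    rw [Bool.eq_false_iff, Ne, Params.passes, List.any_eq_true]
    rintro ⟨r, hr, hfar⟩
    have hrR : r < P.R := List.mem_range.1 hr
    rw [far_eq_true_iff, cntU_bitsOf, show k' = (⟨k', hk'B⟩ : Fin P.B).val from rfl,
      show r = (⟨r, hrR⟩ : Fin P.R).val from rfl, cntX_bitsOf P acc S i ⟨k', hk'B⟩ ⟨r, hrR⟩] at hfar
    have hXg := not_le.1 (hX (P.gOf i ⟨k', hk'B⟩ ⟨r, hrR⟩))
    simp only [Params.ikr_gOf, μX, hne, if_false] at hXg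
    have tri := abs_sub_le (sumX P acc (P.gOf i ⟨k', hk'B⟩ ⟨r, hrR⟩) S) (P.N * pU (n := n) (m := m) acc) (sumU P acc S)
    rw [abs_sub_comm (P.N * pU acc)] at tri
    have e16 : 2 * ((P.N : ℝ) * eta P) = P.N / (8 * P.D) := by rw [hη]; ring
    have hlt : |sumX P acc (P.gOf i ⟨k', hk'B⟩ ⟨r, hrR⟩) S - sumU P acc S| < P.N / (8 * P.D) := by linarith
    have : (4 : ℝ) * P.D * (P.N / (8 * P.D)) = P.N / 2 := by field_simp; ring
    nlinarith [mul_lt_mul_of_pos_left hlt (by positivity : (0 : ℝ) < 4 * P.D)]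
  -- hence the least passing guess is `kk`
  have hfind : (List.range P.B).find? (fun k' => P.passes (Params.bitsOf acc S) i.val k') = some kk :=
    List.find?_range_eq_some.2 ⟨hpass, List.mem_range.2 hkkB, fun j hj => by simp [hfail j hj]⟩
  show ((P.guess (Params.bitsOf acc S) i.val : ℕ) : ZMod q) = s i
  rw [Params.guess, hfind, Option.getD_some, hcast]

/-! ### The success probability -/

/-- The total failure bound `2D/R + 64 D² (1 + nBR)/N`. [cite: RegevLWE2009, §4 Lemma 4.1–4.2] -/
def failBound (P : Params) (n : ℕ) : ℝ :=
  2 * P.D / P.R + 64 * (P.D : ℝ) ^ 2 * (1 + n * P.B * P.R) / P.N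

/-- The failure bound is nonnegative. [folklore] -/
theorem failBound_nonneg (P : Params) (n : ℕ) : 0 ≤ failBound P n := by
  unfold failBound; positivity

/-- **Main estimate (every secret).** For a prime modulus `q ≤ B`, `n, m ≥ 1`, `R, N, D ≥ 1` and an
acceptance predicate of average-case advantage `≥ 1/D` on `m` samples, the reduction fed with
`A_{s,χ}^{m'}` outputs `s` with probability at least `1 - (2D/R + 64 D² (1 + nBR)/N)`.
[cite: RegevLWE2009, §4 Lemma 4.1–4.2] -/
theorem le_prob_solve_eq [Fact (Nat.Prime q)] (hn : 0 < n) (hm : 0 < m) (hB : q ≤ P.B) (hR : 0 < P.R)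
    (hN : 0 < P.N) (hD : 0 < P.D)
    (hadv : (1 / P.D : ℝ) ≤ distinguishingAdvantage χ m (fun b => PMF.pure (acc b))) :
    ENNReal.ofReal (1 - failBound P n) ≤
      (lweSamples χ s (P.total n m)).toOuterMeasure {S | Params.solve acc S = s} := by
  -- failure lies in the union of the bad events
  have hsub : {S : Fin (P.total n m) → (Fin n → ZMod q) × ZMod q | Params.solve acc S = s}ᶜ ⊆
      ({S | badShift P χ acc s S} ∪ {S | badU P acc S}) ∪ ⋃ g, {S | badX P χ acc s g S} := by
    intro S hS
    by_contra hnot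
    simp only [Set.mem_union, Set.mem_iUnion, Set.mem_setOf_eq, not_or, not_exists] at hnot
    exact hS (solve_eq_of_good P χ acc s hB hN hD S hnot.1.1 hnot.1.2 hnot.2)
  have hfail : (lweSamples χ s (P.total n m)).toOuterMeasure {S | Params.solve acc S = s}ᶜ ≤
      ENNReal.ofReal (failBound P n) := by
    refine (MeasureTheory.measure_mono hsub).trans ?_
    refine (MeasureTheory.measure_union_le _ _).trans ?_
    refine (add_le_add (MeasureTheory.measure_union_le _ _) (MeasureTheory.measure_iUnion_fintype_le _ _)).trans ?_
    refine (add_le_add (add_le_add (prob_badShift_le P χ acc s hm hR hD hadv) (prob_badU_le P χ acc s hn hN hD))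
      (Finset.sum_le_sum fun g _ => prob_badX_le P χ acc s hN hD g)).trans ?_
    rw [Finset.sum_const, Finset.card_univ, Fintype.card_fin, nsmul_eq_mul, ← ENNReal.ofReal_natCast,
      ← ENNReal.ofReal_mul (by positivity), ← ENNReal.ofReal_add (by positivity) (by positivity),
      ← ENNReal.ofReal_add (by positivity) (by positivity)]
    refine ENNReal.ofReal_le_ofReal (le_of_eq ?_)
    unfold failBound Params.groups
    push_cast
    ring
  rw [ENNReal.ofReal_sub _ (failBound_nonneg P n), ENNReal.ofReal_one]
  exact one_sub_le_toOuterMeasure_of_compl_le _ _ hfail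

/-- **Main estimate (uniform secret).** Under the same hypotheses the average-case success
probability (`searchSuccessProb`) of the deterministic solver `S ↦ solve acc S` on `m' = K·2m` samples
is at least `1 - (2D/R + 64 D² (1 + nBR)/N)`. [cite: RegevLWE2009, §4 Lemma 4.1–4.2] -/
theorem le_searchSuccessProb_solve [Fact (Nat.Prime q)] (hn : 0 < n) (hm : 0 < m) (hB : q ≤ P.B) (hR : 0 < P.R)
    (hN : 0 < P.N) (hD : 0 < P.D)
    (hadv : (1 / P.D : ℝ) ≤ distinguishingAdvantage χ m (fun b => PMF.pure (acc b))) :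
    ENNReal.ofReal (1 - failBound P n) ≤
      searchSuccessProb χ (P.total n m) (fun S => PMF.pure (Params.solve (P := P) acc S)) := by
  have h : ∀ s', ENNReal.ofReal (1 - failBound P n) ≤
      searchSuccessProbOf χ (P.total n m) (fun S => PMF.pure (Params.solve (P := P) acc S)) s' := by
    intro s'
    unfold searchSuccessProbOf
    rw [show ((lweSamples χ s' (P.total n m)).bind fun S => PMF.pure (Params.solve (P := P) acc S)) =
        (lweSamples χ s' (P.total n m)).map (Params.solve (P := P) acc) from rfl,
      ← PMF.toOuterMeasure_apply_singleton, PMF.toOuterMeasure_map_apply]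
    exact le_prob_solve_eq P χ acc s' hn hm hB hR hN hD hadv
  have hsum : ∑ s', PMF.uniformOfFintype (Fin n → ZMod q) s' = 1 := by
    rw [← tsum_fintype (L := SummationFilter.unconditional _)]
    exact PMF.tsum_coe _
  unfold searchSuccessProb
  calc ENNReal.ofReal (1 - failBound P n)
      = ∑ s', PMF.uniformOfFintype (Fin n → ZMod q) s' * ENNReal.ofReal (1 - failBound P n) := by
        rw [← Finset.sum_mul, hsum, one_mul]
    _ ≤ ∑ s', PMF.uniformOfFintype (Fin n → ZMod q) s' *
          searchSuccessProbOf χ (P.total n m) (fun S => PMF.pure (Params.solve (P := P) acc S)) s' :=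
        Finset.sum_le_sum fun s' _ => by gcongr; exact h s'

end Main

end DecisionToSearch

end LWE

end Literature.Computability.Cryptography

end
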